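import Literature.Claims.NS.Fathi2025
import Literature.Analysis.FluidPDE.ForcedClassicalBlowupAlternative
import Literature.Analysis.FluidPDE.CompactSupportClayForce
import HarnessLib

/-!
# C150 `Fathi2025` — salvage: the forced local-well-posedness + continuation dichotomy
# (`Step23_local`, §2.3 p.3 l.1–8) is TRUE

Skeleton `Literature.Claims.NS.Fathi2025` (ns-claims-typist-12 g5, p525980; row C150 ADJUDICATED #135:
false lemma at `Step41_used`, by `…Theorems.Fathi2025.not_Step41_used` p528077). The ON-PATH binder `h23`
of `claim_of_steps` — `Step23_local`: for `ν > 0`, a class datum (`Chae2007.IsDatum`: smooth,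
divergence free, all derivatives in `L²`) and a force of the class (`IsForce`: `C^∞` and compactly
supported in space–time), EITHER a global forced class solution exists OR there are `T > 0` and a forced
class solution on `[0, T)` blowing up at `T` (`Chae2007.BlowsUpAt`: squared `H³` size unbounded on
`[0, T)`) — is the forced twin of `Chae2007.Step_1` and is PROVED here from the tree's forced blow-up
alternative `Literature.Analysis.FluidPDE.exists_global_forced_sobolevClass_or_blowup`
(`ForcedClassicalBlowupAlternative.lean`: Tao 2013 Thm. 5.4 (ii)+(iv) with force, discharged, +
uniqueness with bounded Sobolev norms + restart–glue; Lemarié-Rieusset 2016 Thm. 7.2), the compactly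
supported force being Clay-class by `clayForce_of_hasCompactSupport`.

* `step23_local_holds : Literature.Claims.NS.Fathi2025.Step23_local`.

Records-grade (TRUE column of the per-step table; the row's locator/class are the refuter's and are
untouched). ns-claims-salvage-p2 g6, 2026-08-27.

WHAT THIS IS NOT: not a claim about NS regularity or blow-up; not a claim about any author beyond
the typed locator.
-/

noncomputable section

set_option linter.dupNamespace false

open Set MeasureTheory
open scoped ENNReal NNReal ContDiff

namespace Summit.NavierStokesRegularity.NavierStokesRegularity.Theorems.Fathi2025Salvage

open Literature.Analysis.FluidPDE Literature.Claims.NS.Fathi2025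
open Literature.Claims.NS.Chae2007 (IsDatum BlowsUpAt)

/-- **Step 2.3′ holds** (§2.3 p.3 l.1–8 with Lemma 2.3 p.2: local well-posedness + continuation for the
FORCED system, as the dichotomy): for `ν > 0`, a class datum and a `C^∞` compactly supported force,
either a global forced class solution exists or some forced class solution on a half-open slab `[0, T)`,
`T > 0`, has unbounded squared `H³` size there. From
`Literature.Analysis.FluidPDE.exists_global_forced_sobolevClass_or_blowup` (classical: Kato; Tao 2013,
Thm. 5.4 with force; Lemarié-Rieusset 2016, Thm. 7.2).
[cite: Fathi2025, §2.3 p.3 l.1–8] [cite: LemarieRieusset2016, Thm. 7.2] [cite: Tao2011, Thm. 5.4 (ii)+(iv)] -/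
theorem step23_local_holds : Step23_local := by
  intro ν hν v₀ hv₀ f hf
  obtain ⟨hfs, hfd⟩ := clayForce_of_hasCompactSupport hf.1 hf.2
  obtain ⟨hsm, hdiv, hH⟩ := hv₀
  rcases exists_global_forced_sobolevClass_or_blowup hν hfs hfd hsm hdiv hH with
    ⟨u, p, hcl, hu0, hB, -⟩ | ⟨Ts, hTs, u, p, hcl, hu0, hBloc, -, hH3, -⟩
  · exact Or.inl ⟨u, p, ⟨hcl, hu0, fun T'' => hB T''⟩⟩
  · exact Or.inr ⟨Ts, hTs, u, p, ⟨hcl, hu0, hBloc⟩, hH3⟩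

end Summit.NavierStokesRegularity.NavierStokesRegularity.Theorems.Fathi2025Salvage

end
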